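import Literature.Computability.QuantumComplexity.AdviceChainStages
import Literature.Computability.Complexity.CyclicListBricks
import HarnessLib

/-!
# Numeric advice from a quantum subroutine, amplified by the median, II: the composition theorem

Topic `Literature/Computability/QuantumComplexity`; sequel of `AdviceChainStages.lean` (the stage
family `AdviceChain.exists_stageFamily` and the bookkeeping lemmas). The GENERIC plumbing behind
every "compute a numeric invariant with one bounded-error quantum algorithm, then use it as advice
for a second one" (e.g. the regulator of a number field feeding the computation of its class
group, Hallgren 2005, §1; Buchmann–Williams): since the advice cannot be checked, the first
algorithm is repeated and the MEDIAN of its answers is taken — sound as soon as the good answers of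
a query form an interval (Jerrum–Valiant–Vazirani 1986, Lemma 6.1) — and the number of good
answers among independent repetitions of a `2/3`-correct machine dominates a binomial law
(Bennett–Bernstein–Brassard–Vazirani 1997, Thm. 4.13); the second algorithm is then a subroutine
call on a computed input (BBBV 1997, Thm. 4.14; Bernstein–Vazirani 1997, §8), all stages being
composed in the tree's circuit model by the sequential chain combinator (`SeqChain.family`,
`SeqChain.chainLaw_toOuterMeasure_le_kernel`, `SeqChain.family_isUniform`,
`SeqChain.family_isOracleFree`; Nielsen–Chuang 2010, §4.4: deferred measurement).

* **`AdviceChain.isQSolvable_of_numericAdvice`** — `qry ∈ FP`, the advice relation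
  `q ↦ {⟨bin r, t⟩ | good q r}` (on well-formed `q`) `IsQSolvable` with interval-shaped good
  sets, and a main stage (`pre, post ∈ FP`, an oracle-free uniform family) succeeding with
  probability `≥ 11/12` on good advice ⟹ `w ↦ {⟨o, t⟩ | Good₂ w o}` (on well-formed `w`) is
  `IsQSolvable`. Five advice runs suffice: `Pr[Bin(5, 2/3) ≥ 3]·(11/12) = (192/243)·(11/12) ≥ 2/3`.

Everything here is proved; no definition and no named fact is introduced.

## References

* C. H. Bennett, E. Bernstein, G. Brassard, U. Vazirani, *Strengths and weaknesses of quantum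
  computing*, SIAM J. Comput. 26 (1997) 1510–1523, Thm. 4.13, Thm. 4.14
  [BennettBernsteinBrassardVazirani1997].
* E. Bernstein, U. Vazirani, *Quantum complexity theory*, SIAM J. Comput. 26 (1997), §8
  [BernsteinVazirani1997].
* M. R. Jerrum, L. G. Valiant, V. V. Vazirani, *Random generation of combinatorial structures from
  a uniform distribution*, Theoret. Comput. Sci. 43 (1986) 169–188, Lemma 6.1
  [JerrumValiantVazirani1986].
* M. A. Nielsen, I. L. Chuang, *Quantum Computation and Quantum Information*, CUP 2010, §4.4
  [NielsenChuang2010].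
* S. Hallgren, *Fast quantum algorithms for computing the unit group and class group of a number
  field*, STOC 2005, §1 [Hallgren2005].
-/

noncomputable section

namespace Literature.Computability.QuantumComplexity

namespace AdviceChain

open _root_.Computability Complexity Complexity.Brick Cryptography Polynomial

/-- **Numeric advice from a bounded-error quantum subroutine, amplified by the median, feeding one
further quantum stage ⟹ `IsQSolvable`.** Let `qry ∈ FP` map well-formed inputs `w` (`WF₂ w`) to
well-formed queries (`WF (qry w)`); let the ADVICE relation — on a well-formed query `q` output
`⟨bin r, t⟩` with `good q r` — be solvable in bounded-error quantum polynomial time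
(`IsQSolvable`), the good values of each query forming an interval; and let a MAIN STAGE be given:
`pre, post ∈ FP` and an oracle-free uniform Clifford+`T` family `F` which, run on `pre ⟨w, bin r⟩`
for good advice `r` and post-processed by `post ⟨⟨w, bin r⟩, ·⟩`, reaches `Good₂ w` with
probability `≥ 11/12`. Then `w ↦ {⟨o, t⟩ | Good₂ w o}` (nothing required off `WF₂`) is
`IsQSolvable`. Proof: the stage family of `AdviceChain.exists_stageFamily` is run six times by
the sequential chain combinator (`SeqChain.family`; window polynomial wide enough for the coded
list of five canonical answers and for `⟨post _, []⟩`): stages `0, …, 4` run the advice solver on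
`qry w` and append the canonical numeral of the answer to the list in the window, stage `5` sorts
the list by value (`Brick.isortFn`), reads its middle item `bin r̃` and runs the main stage on
`pre ⟨w, bin r̃⟩`. Along the chain law (`StageChains.chainLaw`, an iterated `PMF.bind`) the number
of good answers dominates the binomial law `Bin(k, 2/3)` (`le_toOuterMeasure_bind_two`: every
answer is good with probability `≥ 2/3` conditionally on the past), so at least three of the five
answers are good with probability `≥ Pr[Bin(5, 2/3) ≥ 3] = 192/243`; then the median is good
(`good_getD_of_majority`, the interval hypothesis), the main stage succeeds with probability
`≥ 11/12`, and `(192/243)·(11/12) ≥ 2/3`. The last window is a prefix of the measured register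
(`SeqChain.chainLaw_toOuterMeasure_le_kernel`), and `⟨o, []⟩ <+: z` forces `z = ⟨o, t⟩`.
[cite: BennettBernsteinBrassardVazirani1997, Thm. 4.13 (repetitions and voting), Thm. 4.14 (subroutines)]
[cite: JerrumValiantVazirani1986, Lemma 6.1 (the median trick)] -/
theorem isQSolvable_of_numericAdvice
    (WF : List Bool → Prop) (good : List Bool → ℕ → Prop) (qry : List Bool → List Bool)
    (WF₂ : List Bool → Prop) (Good₂ : List Bool → List Bool → Prop)
    (hqry : qry ∈ FP) (hWF : ∀ w, WF₂ w → WF (qry w))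
    (hconv : ∀ (q : List Bool) (r₁ r₂ r : ℕ), good q r₁ → good q r₂ → r₁ ≤ r → r ≤ r₂ → good q r)
    (hA : IsQSolvable
      (fun q => {y | WF q → ∃ (r : ℕ) (t : List Bool), y = boolPair (encodeNat r) t ∧ good q r}))
    (hmain : ∃ (pre post : List Bool → List Bool), pre ∈ FP ∧ post ∈ FP ∧
        ∃ F : QCircuitFamily cliffordT, F.IsOracleFree ∧ F.IsUniform ∧
          ∀ (w : List Bool) (r : ℕ), WF₂ w → good (qry w) r →
            (11 : ℝ) / 12 ≤ F.kernelProb 0 (pre (boolPair w (encodeNat r)))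
              {y | Good₂ w (post (boolPair (boolPair w (encodeNat r)) y))}) :
    IsQSolvable (fun w => {z | WF₂ w → ∃ (o t : List Bool), z = boolPair o t ∧ Good₂ w o}) := by
  classical
  -- the binomial tail `t k j = Pr[Bin(k, 2/3) ≥ j]`, by its Pascal recursion
  obtain ⟨t, ht0, ht0', htS⟩ : ∃ t : ℕ → ℕ → ℝ, t 0 0 = 1 ∧ (∀ j, t 0 (j + 1) = 0) ∧
      ∀ k j, t (k + 1) j = 1 / 3 * t k j + 2 / 3 * t k (j - 1) :=
    ⟨fun k => Nat.rec (motive := fun _ => ℕ → ℝ) (fun j => if j = 0 then 1 else 0)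
      (fun _ f j => 1 / 3 * f j + 2 / 3 * f (j - 1)) k, by simp, fun j => by simp, fun k j => rfl⟩
  have ht_nonneg : ∀ k j, 0 ≤ t k j := by
    intro k
    induction k with
    | zero => intro j; cases j <;> simp [ht0, ht0']
    | succ k ih =>
      intro j
      rw [htS]
      have := ih j
      have := ih (j - 1)
      positivity
  have ht53 : t 5 3 = 192 / 243 := by
    simp only [htS, ht0, ht0', Nat.succ_sub_one, Nat.reduceSub]
    norm_num
  obtain ⟨FA, hAfree, hAU, hFA⟩ := hA
  obtain ⟨pre, post, hpre, hpost, F, hFfree, hFU, hF⟩ := hmain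
  -- the median extractor `med y = (sorted list of the window)[2]`
  set med : List Bool → List Bool := fstF ∘ sndF ∘ sndF ∘ isortFn ∘ fstF with hmed_def
  have hmed : med ∈ FP := comp_mem_FP fstF_mem_FP (comp_mem_FP sndF_mem_FP (comp_mem_FP sndF_mem_FP
    (comp_mem_FP isortFn_mem_FP fstF_mem_FP)))
  obtain ⟨S, hSfree, hSU, hS0, hS1⟩ :=
    exists_stageFamily 5 (by norm_num) hqry hpre hpost hmed hAfree hAU hFfree hFU
  -- polynomial bounds
  obtain ⟨pS, hpS⟩ := QCircuitFamily.IsUniform.isPolySize_holds hSU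
  obtain ⟨pA, hpA⟩ := QCircuitFamily.IsUniform.isPolySize_holds hAU
  obtain ⟨pF, hpF⟩ := QCircuitFamily.IsUniform.isPolySize_holds hFU
  obtain ⟨pq, hpq⟩ := exists_poly_length_le_of_mem_FP hqry
  obtain ⟨ppre, hppre⟩ := exists_poly_length_le_of_mem_FP hpre
  obtain ⟨ppost, hppost⟩ := exists_poly_length_le_of_mem_FP hpost
  set Bitem : Polynomial ℕ := pq + pA.comp pq + 1 with hBitem
  set Bv : Polynomial ℕ := C 2 * X + C 2 + Bitem with hBv
  set Bz : Polynomial ℕ := C 2 * Bv + C 2 + (ppre.comp Bv + pF.comp (ppre.comp Bv)) with hBz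
  set pm : Polynomial ℕ := C 20 * (Bitem + 1) + C 2 + (C 2 * ppost.comp Bz + C 2) with hpm
  have hBitem_eval : ∀ n, Bitem.eval n = pq.eval n + pA.eval (pq.eval n) + 1 := fun n => by
    simp only [hBitem, eval_add, eval_comp, eval_one]
  have hBv_eval : ∀ n, Bv.eval n = 2 * n + 2 + Bitem.eval n := fun n => by
    simp only [hBv, eval_add, eval_mul, eval_C, eval_X]
  have hBz_eval : ∀ n, Bz.eval n = 2 * Bv.eval n + 2 +
      (ppre.eval (Bv.eval n) + pF.eval (ppre.eval (Bv.eval n))) := fun n => by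
    simp only [hBz, eval_add, eval_mul, eval_C, eval_comp]
  have hpm_eval : ∀ n, pm.eval n = 20 * (Bitem.eval n + 1) + 2 + (2 * ppost.eval (Bz.eval n) + 2) :=
    fun n => by simp only [hpm, eval_add, eval_mul, eval_C, eval_comp, eval_one]
  obtain ⟨P, hPS, hPT, hPm⟩ : ∃ P : SeqChain.Params, P.S = S ∧ P.T = C 6 ∧ P.m = pm :=
    ⟨⟨S, pS, fun n => (hpS n).2, C 6, pm⟩, rfl, rfl, rfl⟩
  refine ⟨SeqChain.family P, SeqChain.family_isOracleFree (by rw [hPS]; exact hSfree),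
    SeqChain.family_isUniform P (by rw [hPS]; exact hSU), fun w => ?_⟩
  dsimp only
  by_cases hw : WF₂ w
  swap
  · have huniv :
        {z : List Bool | WF₂ w → ∃ o t : List Bool, z = boolPair o t ∧ Good₂ w o} = Set.univ :=
      Set.eq_univ_of_forall fun z h => absurd h hw
    rw [huniv, kernelProb_univ]
    norm_num
  set n := w.length with hn
  set q := qry w with hq
  have hWFq : WF q := hWF w hw
  set m := pm.eval n with hm
  -- the items written by the advice stages are short canonical numerals
  have hitem : ∀ y' ∈ (FA.kernel 0 q).support, (canonF (fstF y')).length ≤ Bitem.eval n := by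
    intro y' hy'
    have h1 := length_canonF_le (fstF y')
    have h2 := length_fstF_sndF_le y'
    have h3 := length_of_mem_support_kernel FA 0 q y' hy'
    have h4 : q.length ≤ pq.eval n := hpq w
    have h5 : FA.ancillas q.length ≤ pA.eval (pq.eval n) :=
      (hpA q.length).2.trans (SeqChain.eval_mono_nat pA h4)
    rw [hBitem_eval]
    omega
  have hcanon : ∀ y' : List Bool, ∃ r : ℕ, canonF (fstF y') = encodeNat r :=
    fun y' => ⟨decodeNat (fstF y'), canonF_eq_encodeNat_decodeNat _⟩
  -- the events along the chain: `k` items recorded, at least `j` of them good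
  set gd : List Bool → Bool := fun a => decide (good q (bitsToNat a)) with hgd
  obtain ⟨E, hE⟩ : ∃ E : ℕ → ℕ → Set (List Bool), ∀ k j y, y ∈ E k j ↔
      ∃ items : List (List Bool), fstF y = encList items ∧ items.length = k ∧
        (∀ a ∈ items, (∃ r : ℕ, a = encodeNat r) ∧ a.length ≤ Bitem.eval n) ∧ j ≤ items.countP gd :=
    ⟨fun k j => {y | ∃ items : List (List Bool), fstF y = encList items ∧ items.length = k ∧
        (∀ a ∈ items, (∃ r : ℕ, a = encodeNat r) ∧ a.length ≤ Bitem.eval n) ∧ j ≤ items.countP gd},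
      fun _ _ _ => Iff.rfl⟩
  -- one advice stage from a window holding a list of `k < 5` items
  have hstep : ∀ (k : ℕ) (y : List Bool) (items : List (List Bool)), k < 5 →
      fstF y = encList items → items.length = k →
      (∀ a ∈ items, (∃ r : ℕ, a = encodeNat r) ∧ a.length ≤ Bitem.eval n) →
      ∀ Ev : Set (List Bool), Ev ⊆ (FA.kernel 0 q).support →
      ENNReal.ofReal (FA.kernelProb 0 q Ev) ≤
        ((S.kernel 0 (stageInput w k y)).map fun z => z.takeD m false).toOuterMeasure
          {y₂ | ∃ y' ∈ Ev, fstF y₂ = encList (items ++ [canonF (fstF y')])} := by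
    intro k y items hk hy hlen hitems Ev hEv
    rw [PMF.toOuterMeasure_map_apply]
    have h1 := ENNReal.ofReal_le_ofReal (hS0 w k y hk Ev)
    rw [ofReal_kernelProb S] at h1
    refine h1.trans ((S.kernel 0 (stageInput w k y)).toOuterMeasure.mono ?_)
    rintro z ⟨y', hy', hz⟩
    refine ⟨y', hy', ?_⟩
    rw [hy] at hz
    have hfit : (boolPair (encList items ++ boolPair (canonF (fstF y')) []) []).length ≤ m := by
      have h2 := length_encList_le (l := items) (B := Bitem.eval n) fun a ha => (hitems a ha).2
      have h3 := hitem y' (hEv hy')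
      have h4 : items.length * (2 * Bitem.eval n + 2) ≤ 4 * (2 * Bitem.eval n + 2) :=
        Nat.mul_le_mul_right _ (by omega)
      rw [length_boolPair, List.length_append, length_boolPair, List.length_nil, hm, hpm_eval]
      omega
    obtain ⟨s, hs⟩ := exists_eq_boolPair_of_prefix (OracleWrap.prefix_takeD hz hfit)
    change fstF (z.takeD m false) = _
    rw [hs, fstF_boolPair, encList_append, encList_cons, encList_nil]
  -- the next window is structured; its new item is counted when good
  have hEsucc : ∀ (k j : ℕ) (items : List (List Bool)) (y' y₂ : List Bool),
      items.length = k → (∀ a ∈ items, (∃ r : ℕ, a = encodeNat r) ∧ a.length ≤ Bitem.eval n) →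
      y' ∈ (FA.kernel 0 q).support → fstF y₂ = encList (items ++ [canonF (fstF y')]) →
      j ≤ items.countP gd + (if gd (canonF (fstF y')) = true then 1 else 0) → y₂ ∈ E (k + 1) j := by
    intro k j items y' y₂ hlen hitems hy' hy₂ hj
    refine (hE _ _ _).2 ⟨items ++ [canonF (fstF y')], hy₂,
      by rw [List.length_append, List.length_singleton, hlen], ?_, ?_⟩
    · intro a ha
      rcases List.mem_append.1 ha with ha | ha
      · exact hitems a ha
      · rw [List.mem_singleton.1 ha]
        exact ⟨hcanon y', hitem y' hy'⟩
    · rwa [List.countP_append, List.countP_cons, List.countP_nil, zero_add]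
  -- the number of good items dominates a binomial with success probability `2/3`
  have hind : ∀ k ≤ 5, ∀ j,
      ENNReal.ofReal (t k j) ≤ (chainLaw 0 S m w k).toOuterMeasure (E k j) := by
    intro k
    induction k with
    | zero =>
      intro _ j
      cases j with
      | zero =>
        rw [chainLaw_zero, PMF.toOuterMeasure_pure_apply, if_pos]
        · simp [ht0]
        · exact (hE _ _ _).2 ⟨[], by simp, rfl, fun a ha => absurd ha List.not_mem_nil, le_rfl⟩
      | succ j => simp [ht0']
    | succ k ih =>
      intro hk j
      have hk' : k < 5 := by omega
      have hAB : E k j ⊆ E k (j - 1) := fun y hy => by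
        obtain ⟨items, h1, h2, h3, h4⟩ := (hE _ _ _).1 hy
        exact (hE _ _ _).2 ⟨items, h1, h2, h3, (Nat.sub_le j 1).trans h4⟩
      -- from a structured window the next window is structured, surely
      have hsure : ∀ j', ∀ y ∈ E k j', 1 ≤ ((S.kernel 0 (stageInput w k y)).map
          fun z => z.takeD m false).toOuterMeasure (E (k + 1) j') := by
        intro j' y hy
        obtain ⟨items, hy, hlen, hitems, hj'⟩ := (hE _ _ _).1 hy
        have h := hstep k y items hk' hy hlen hitems (FA.kernel 0 q).support subset_rfl
        rw [kernelProb_support, ENNReal.ofReal_one] at h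
        refine h.trans (MeasureTheory.OuterMeasure.mono _ ?_)
        rintro y₂ ⟨y', hy', hy₂⟩
        exact hEsucc k j' items y' y₂ hlen hitems hy' hy₂ (hj'.trans (Nat.le_add_right _ _))
      -- and with probability `≥ 2/3` the new item is good
      have hgood : ∀ y ∈ E k (j - 1), ENNReal.ofReal (2 / 3) ≤ ((S.kernel 0 (stageInput w k y)).map
          fun z => z.takeD m false).toOuterMeasure (E (k + 1) j) := by
        intro y hyE
        rcases Nat.eq_zero_or_pos j with rfl | hj
        · exact le_trans (ENNReal.ofReal_le_one.2 (by norm_num)) (hsure 0 y hyE)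
        obtain ⟨items, hy, hlen, hitems, hj'⟩ := (hE _ _ _).1 hyE
        have h := hstep k y items hk' hy hlen hitems
          ({y' | WF q → ∃ (r : ℕ) (t : List Bool), y' = boolPair (encodeNat r) t ∧ good q r} ∩
            (FA.kernel 0 q).support) Set.inter_subset_right
        rw [kernelProb_inter_support] at h
        refine ((ENNReal.ofReal_le_ofReal (hFA q)).trans h).trans
          (MeasureTheory.OuterMeasure.mono _ ?_)
        rintro y₂ ⟨y', ⟨hy'R, hy's⟩, hy₂⟩
        refine hEsucc k j items y' y₂ hlen hitems hy's hy₂ ?_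
        obtain ⟨r, t, rfl, hr⟩ := hy'R hWFq
        have hval : gd (canonF (fstF (boolPair (encodeNat r) t))) = true := by
          simp only [hgd, fstF_boolPair, canonF_eq_encodeNat_decodeNat, decode_encodeNat,
            bitsToNat_encodeNat, hr, decide_true]
        rw [hval, if_pos rfl]
        omega
      have h2 := le_toOuterMeasure_bind_two (p := chainLaw 0 S m w k)
        (q := fun y => (S.kernel 0 (stageInput w k y)).map fun z => z.takeD m false)
        (c := ENNReal.ofReal (1 / 3)) (d := ENNReal.ofReal (2 / 3)) (E := E (k + 1) j) hAB
        (fun y hy => ?_) hgood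
      · rw [chainLaw_succ, htS, ENNReal.ofReal_add (by have := ht_nonneg k j; positivity)
          (by have := ht_nonneg k (j - 1); positivity), ENNReal.ofReal_mul (by norm_num),
          ENNReal.ofReal_mul (by norm_num)]
        exact le_trans (add_le_add (mul_le_mul' le_rfl (ih (by omega) j))
          (mul_le_mul' le_rfl (ih (by omega) (j - 1)))) h2
      · rw [← ENNReal.ofReal_add (by norm_num) (by norm_num),
          show (1 : ℝ) / 3 + 2 / 3 = 1 by norm_num, ENNReal.ofReal_one]
        exact hsure j y hy
  -- the main stage, from a window holding five items, at least three of them good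
  obtain ⟨Fin, hFin⟩ :
      ∃ Fin : Set (List Bool), ∀ v, v ∈ Fin ↔ ∃ o, Good₂ w o ∧ boolPair o [] <+: v :=
    ⟨{v | ∃ o, Good₂ w o ∧ boolPair o [] <+: v}, fun _ => Iff.rfl⟩
  have hlast : ENNReal.ofReal (11 / 12) * (chainLaw 0 S m w 5).toOuterMeasure (E 5 3) ≤
      (chainLaw 0 S m w 6).toOuterMeasure Fin := by
    rw [show (6 : ℕ) = 5 + 1 from rfl, chainLaw_succ 0 S m w 5]
    have h := le_toOuterMeasure_bind_two (p := chainLaw 0 S m w 5)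
      (q := fun y => (S.kernel 0 (stageInput w 5 y)).map fun z => z.takeD m false)
      (c := ENNReal.ofReal (11 / 12)) (d := 0) (E := Fin) (subset_refl (E 5 3)) ?_
      (fun _ _ => bot_le)
    · simpa using h
    intro y hyE
    obtain ⟨items, hy, hlen, hitems, hcnt⟩ := (hE _ _ _).1 hyE
    rw [add_zero, PMF.toOuterMeasure_map_apply]
    -- the sorted list and its middle item
    set srt := Com.isortModel [] items with hsrt
    have hperm : srt.Perm items := by simpa using Com.perm_isortModel items []
    have hsorted : srt.Pairwise FPRASAmp.ValLE :=
      FPRASAmp.pairwise_isortModel items [] List.Pairwise.nil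
    have hlen' : srt.length = 5 := by rw [hperm.length_eq, hlen]
    have hmedval : med y = srt.getD 2 [] := by
      have e : med y = fstF (sndF^[2] (isortFn (fstF y))) := rfl
      rw [e, hy, isortFn_encList]
      exact fstF_iterate_sndF_encList 2 srt
    have hmaj : srt.length < 2 * srt.countP gd := by rw [hperm.countP_eq, hlen']; omega
    have hgoodmed : good q (bitsToNat (srt.getD 2 [])) := by
      have := good_getD_of_majority (hconv q) hsorted hmaj
      rwa [hlen'] at this
    have h2lt : 2 < srt.length := by omega
    have hmem : srt.getD 2 [] ∈ items := by
      rw [List.getD_eq_getElem?_getD, List.getElem?_eq_getElem h2lt, Option.getD_some]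
      exact hperm.mem_iff.1 (List.getElem_mem h2lt)
    obtain ⟨r, hr⟩ : ∃ r : ℕ, srt.getD 2 [] = encodeNat r := (hitems _ hmem).1
    have hmedlen : (med y).length ≤ Bitem.eval n := hmedval ▸ (hitems _ hmem).2
    have hmedr : med y = encodeNat r := hmedval.trans hr
    have hgoodr : good q r := by rwa [hr, bitsToNat_encodeNat] at hgoodmed
    -- run the main stage on `pre ⟨w, med y⟩`
    have h1 := hF w r hw hgoodr
    rw [← hmedr] at h1
    have h2 := hS1 w y ({y'' | Good₂ w (post (boolPair (boolPair w (med y)) y''))} ∩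
      (F.kernel 0 (pre (boolPair w (med y)))).support)
    rw [kernelProb_inter_support] at h2
    have h3 := ENNReal.ofReal_le_ofReal (h1.trans h2)
    rw [ofReal_kernelProb S] at h3
    refine h3.trans ((S.kernel 0 (stageInput w 5 y)).toOuterMeasure.mono ?_)
    rintro z ⟨y'', ⟨hG, hsupp⟩, hz⟩
    refine (hFin _).2 ⟨post (boolPair (boolPair w (med y)) y''), hG, OracleWrap.prefix_takeD hz ?_⟩
    -- the written string fits into the window
    have hv : (boolPair w (med y)).length ≤ Bv.eval n := by
      rw [length_boolPair, hBv_eval]; omega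
    have hprev : (pre (boolPair w (med y))).length ≤ ppre.eval (Bv.eval n) :=
      (hppre _).trans (SeqChain.eval_mono_nat ppre hv)
    have hy'' : y''.length ≤ ppre.eval (Bv.eval n) + pF.eval (ppre.eval (Bv.eval n)) := by
      rw [length_of_mem_support_kernel F 0 _ y'' hsupp]
      exact add_le_add hprev (((hpF _).2).trans (SeqChain.eval_mono_nat pF hprev))
    have hzlen : (boolPair (boolPair w (med y)) y'').length ≤ Bz.eval n := by
      rw [length_boolPair, hBz_eval]; omega
    have ho : (post (boolPair (boolPair w (med y)) y'')).length ≤ ppost.eval (Bz.eval n) :=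
      (hppost _).trans (SeqChain.eval_mono_nat ppost hzlen)
    rw [length_boolPair, List.length_nil, hm, hpm_eval]
    omega
  -- assembly: the last window is a prefix of the measured register
  have hchain := SeqChain.chainLaw_toOuterMeasure_le_kernel P w 0 Fin
  have hTn : SeqChain.Tn P w.length = 6 := by rw [SeqChain.Tn, hPT, eval_C]
  have hmn : SeqChain.mn P w.length = m := by rw [SeqChain.mn, hPm]
  rw [hTn, hmn, hPS] at hchain
  have hsub : {z : List Bool | ∃ y ∈ Fin, y <+: z} ⊆
      {z | WF₂ w → ∃ (o t : List Bool), z = boolPair o t ∧ Good₂ w o} := by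
    rintro z ⟨y, hy, hyz⟩ _
    obtain ⟨o, ho, hoy⟩ := (hFin y).1 hy
    obtain ⟨s, hs⟩ := exists_eq_boolPair_of_prefix (hoy.trans hyz)
    exact ⟨o, s, hs, ho⟩
  have h5 := hind 5 le_rfl 3
  rw [ht53] at h5
  have hfin : ENNReal.ofReal (11 / 12) * ENNReal.ofReal (192 / 243) ≤
      ((SeqChain.family P).kernel 0 w).toOuterMeasure
        {z | WF₂ w → ∃ (o t : List Bool), z = boolPair o t ∧ Good₂ w o} :=
    (mul_le_mul' le_rfl h5).trans (hlast.trans (hchain.trans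
      (((SeqChain.family P).kernel 0 w).toOuterMeasure.mono hsub)))
  rw [← ENNReal.ofReal_mul (by norm_num)] at hfin
  unfold QCircuitFamily.kernelProb
  have h6 := (ENNReal.ofReal_le_iff_le_toReal (toOuterMeasure_ne_top _ _)).1 hfin
  linarith

end AdviceChain

end Literature.Computability.QuantumComplexity

end
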